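import Summits.ABC.ABC.Theorems.TwistAmplificationMazurKaneLawShapeTransfer
import Literature.NumberTheory.DiophantineGeometry.AbcShapeReductionCount
import Literature.NumberTheory.DiophantineGeometry.AbcExceptionalSetBounds

-- Summit.ABC.ABC is the mandated summit-side namespace (single-conjunct summit); the lakefile sets the same option tree-wide.
set_option linter.dupNamespace false

/-!
# The pointwise transfer "shape law at every `l ∈ (s,2)` ⟹ `MazurKaneLaw` at `s`" (crux stmt-ABC-2757, stub `stub_transfer`)

Stub 1 (`TransferAt`) of the line `critical-kloosterman-powerful-moduli` for the crux
`Summit.ABC.ABC.Theses.TwistAmplification.MazurKaneLaw`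
(`∀ s ∈ (1,2) ∀ ε > 0 ∃ C ∀ N ≥ 2, #{abc triples (a,b,c) : c ≤ N, rad(abc) ≤ c^s} ≤ C · N^{s-1+ε}`).

This is the POINTWISE form of `Summit.ABC.ABC.Theorems.MazurKaneLaw.shapeTransfer`: fix `1 < s < 2`;
if for every `l ∈ (s, 2)`, every `0 < ε' < 1/2` and every `η > 0` the Bernert–Browning–Lichtman–Teräväinen
shape counts satisfy `B_M(c; X, Y, Z) ≤ K · C₀^{l-1+3ε'+η}` on all `Admissible l ε'` data
(`M = numShapes ε'`), then the conclusion of the crux holds at this `s`. Proof, on the pattern of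
`shapeTransfer`:

* given `ε > 0` put `l = min(s + ε/4, (s+2)/2)`, so `s < l < 2` and `l ≤ s + ε/4`;
* take `ε' = min(ε/20, 1/4)`, `η = ε/8`, and the constant `K` of the hypothesis at `(l, ε', η)`, replaced by
  `max K 0 ≥ 0`;
* `AbcShapes.abcExponentCount_le_of_shapeCount_le` (BBLT Prop. 2.1, `θ = l - 1 + 3ε' + η ≥ 0`) bounds
  `N_l(N)` by `max K 0 · #classRange ε' N · N^θ`, and `AbcShapes.card_classRange_le ε' (δ := ε/8)` bounds
  the number of classes by `C · N^{3ε'/2+ε/8}`; the exponents add up to at most `s - 1 + 29ε/40 ≤ s - 1 + ε`;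
* finally, for an abc triple `c ≥ 2`, so `rad(abc) ≤ c^s < c^l`: the set of the crux at `(s, N)` is contained
  in the set counted by `abcExponentCount l N` (this absorbs `≤` versus `<`).
-/

noncomputable section

namespace Summit.ABC.ABC.Theorems.MazurKaneLaw

open Finset Literature.NumberTheory.DiophantineGeometry Literature.NumberTheory.DiophantineGeometry.AbcShapes

/-- **Pointwise transfer of the shape law to the crux `MazurKaneLaw` at a fixed `s ∈ (1,2)`.**
If for every `l ∈ (s,2)`, every `0 < ε' < 1/2` and every `η > 0` there is `K` with
`B_M(c; X, Y, Z) ≤ K · C₀^{l-1+3ε'+η}` on all `Admissible l ε'` data (`M = numShapes ε'`), then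
`#{abc triples, c ≤ N, rad(abc) ≤ c^s} ≤ C · N^{s-1+ε}` for every `ε > 0`, `N ≥ 2`.
Proof: `l = min(s + ε/4, (s+2)/2)`, `ε' = min(ε/20, 1/4)`, `η = ε/8`, `K ↦ max K 0`; the reduction
`abcExponentCount_le_of_shapeCount_le` and the class count `card_classRange_le ε' (δ := ε/8)` give
`N_l(N) ≤ K C · N^{3ε'/2 + ε/8 + l - 1 + 3ε' + ε/8} ≤ K C · N^{s-1+ε}`, and the crux's set lies in the
set of `N_l(N)` because `rad(abc) ≤ c^s < c^l` (`c ≥ 2`). [folklore] -/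
theorem pointTransfer {s : ℝ} (hs1 : 1 < s) (hs2 : s < 2)
    (hBox : ∀ l : ℝ, s < l → l < 2 → ∀ ε : ℝ, 0 < ε → ε < 1 / 2 → ∀ η : ℝ, 0 < η → ∃ K : ℝ,
      ∀ (C₀ c₁ c₂ c₃ : ℕ) (X Y Z : Fin (numShapes ε) → ℕ), Admissible l ε C₀ c₁ c₂ c₃ X Y Z →
        (shapeCount c₁ c₂ c₃ X Y Z : ℝ) ≤ K * (C₀ : ℝ) ^ (l - 1 + 3 * ε + η))
    {ε : ℝ} (hε : 0 < ε) :
    ∃ C : ℝ, ∀ N : ℕ, 2 ≤ N →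
      (Set.ncard {t : ℕ × ℕ × ℕ | IsABCTriple t.1 t.2.1 t.2.2 ∧ t.2.2 ≤ N ∧
        ((rad t.1 t.2.1 t.2.2 : ℕ) : ℝ) ≤ (t.2.2 : ℝ) ^ s} : ℝ) ≤ C * (N : ℝ) ^ (s - 1 + ε) := by
  -- the auxiliary exponent `l ∈ (s, 2)` with `l ≤ s + ε/4`
  obtain ⟨l, hl⟩ : ∃ t : ℝ, t = min (s + ε / 4) ((s + 2) / 2) := ⟨_, rfl⟩
  have hsl : s < l := by rw [hl]; exact lt_min (by linarith) (by linarith)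
  have hl2 : l < 2 := by rw [hl]; exact (min_le_right _ _).trans_lt (by linarith)
  have hlε : l ≤ s + ε / 4 := by rw [hl]; exact min_le_left _ _
  have hl1 : 1 < l := hs1.trans hsl
  -- the small parameter `ε'` and `η = ε/8`
  obtain ⟨ε', hε'⟩ : ∃ t : ℝ, t = min (ε / 20) (1 / 4) := ⟨_, rfl⟩
  have hε'0 : 0 < ε' := by rw [hε']; exact lt_min (by positivity) (by norm_num)
  have hε'ε : ε' ≤ ε / 20 := by rw [hε']; exact min_le_left _ _
  have hε'4 : ε' ≤ 1 / 4 := by rw [hε']; exact min_le_right _ _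
  have hε'2 : ε' < 1 / 2 := by linarith
  have hη : 0 < ε / 8 := by positivity
  -- the shape law at `(l, ε', η = ε/8)`, with a nonnegative constant
  obtain ⟨K, hB⟩ := hBox l hsl hl2 ε' hε'0 hε'2 (ε / 8) hη
  have hK0 : (0 : ℝ) ≤ max K 0 := le_max_right _ _
  have hB' : ∀ (C₀ c₁ c₂ c₃ : ℕ) (X Y Z : Fin (numShapes ε') → ℕ), Admissible l ε' C₀ c₁ c₂ c₃ X Y Z →
      (shapeCount c₁ c₂ c₃ X Y Z : ℝ) ≤ max K 0 * (C₀ : ℝ) ^ (l - 1 + 3 * ε' + ε / 8) :=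
    fun C₀ c₁ c₂ c₃ X Y Z hA =>
      (hB C₀ c₁ c₂ c₃ X Y Z hA).trans (mul_le_mul_of_nonneg_right (le_max_left _ _) (by positivity))
  have hl0 : (0 : ℝ) ≤ l := by linarith
  have hθ0 : (0 : ℝ) ≤ l - 1 + 3 * ε' + ε / 8 := by linarith
  -- the reduction to shape counts and the number of classes
  have hred := abcExponentCount_le_of_shapeCount_le hε'0 hε'2 hl0 hθ0 hK0 hB'
  obtain ⟨C, hC0, hC⟩ := card_classRange_le ε' (δ := ε / 8) hη
  refine ⟨max K 0 * C, fun N hN => ?_⟩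
  have hN1 : (1 : ℝ) ≤ N := by exact_mod_cast (show 1 ≤ N by omega)
  have hN0 : (0 : ℝ) < N := by positivity
  -- the crux's set at `(s, N)` lies in the set counted by `abcExponentCount l N` (`c ≥ 2`)
  have hsub : {t : ℕ × ℕ × ℕ | IsABCTriple t.1 t.2.1 t.2.2 ∧ t.2.2 ≤ N ∧
      ((rad t.1 t.2.1 t.2.2 : ℕ) : ℝ) ≤ (t.2.2 : ℝ) ^ s} ⊆
      {t : ℕ × ℕ × ℕ | IsABCTriple t.1 t.2.1 t.2.2 ∧ t.2.2 ≤ N ∧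
        ((rad t.1 t.2.1 t.2.2 : ℕ) : ℝ) < (t.2.2 : ℝ) ^ l} := by
    rintro t ⟨ht, hN', hle⟩
    refine ⟨ht, hN', hle.trans_lt ?_⟩
    have h2 : (1 : ℝ) < (t.2.2 : ℝ) := by
      obtain ⟨ha, hb, habc, -⟩ := ht
      have : 2 ≤ t.2.2 := by omega
      exact_mod_cast this
    exact Real.rpow_lt_rpow_of_exponent_lt h2 hsl
  have h1 : (Set.ncard {t : ℕ × ℕ × ℕ | IsABCTriple t.1 t.2.1 t.2.2 ∧ t.2.2 ≤ N ∧
      ((rad t.1 t.2.1 t.2.2 : ℕ) : ℝ) ≤ (t.2.2 : ℝ) ^ s} : ℝ) ≤ (abcExponentCount l N : ℝ) := by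
    rw [abcExponentCount_def]
    exact_mod_cast Set.ncard_le_ncard hsub (abcExponentCount_finite _ N)
  -- the exponents: `3ε'/2 + ε/8 + l - 1 + 3ε' + ε/8 ≤ s - 1 + ε`
  have hexp : (N : ℝ) ^ (3 * ε' / 2 + ε / 8) * (N : ℝ) ^ (l - 1 + 3 * ε' + ε / 8) ≤
      (N : ℝ) ^ (s - 1 + ε) := by
    rw [← Real.rpow_add hN0]
    exact Real.rpow_le_rpow_of_exponent_le hN1 (by linarith)
  calc (Set.ncard {t : ℕ × ℕ × ℕ | IsABCTriple t.1 t.2.1 t.2.2 ∧ t.2.2 ≤ N ∧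
          ((rad t.1 t.2.1 t.2.2 : ℕ) : ℝ) ≤ (t.2.2 : ℝ) ^ s} : ℝ)
        ≤ (abcExponentCount l N : ℝ) := h1
    _ ≤ max K 0 * (classRange ε' N).card * (N : ℝ) ^ (l - 1 + 3 * ε' + ε / 8) := hred N
    _ ≤ max K 0 * (C * (N : ℝ) ^ (3 * ε' / 2 + ε / 8)) * (N : ℝ) ^ (l - 1 + 3 * ε' + ε / 8) :=
        mul_le_mul_of_nonneg_right (mul_le_mul_of_nonneg_left (hC N hN) hK0) (by positivity)
    _ = max K 0 * C * ((N : ℝ) ^ (3 * ε' / 2 + ε / 8) * (N : ℝ) ^ (l - 1 + 3 * ε' + ε / 8)) := by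
        ring
    _ ≤ max K 0 * C * (N : ℝ) ^ (s - 1 + ε) := mul_le_mul_of_nonneg_left hexp (mul_nonneg hK0 hC0.le)

/-- **STUB 1 · `stub_transfer`** of the line `critical-kloosterman-powerful-moduli` (crux stmt-ABC-2757): the
shape law `B_M ≤ K · C₀^{l-1+3ε'+η}` at every `l ∈ (s,2)`, every `0 < ε' < 1/2`, every `η > 0` implies the
Mazur–Kane law `#{abc triples, c ≤ N, rad(abc) ≤ c^s} ≤ C · N^{s-1+ε}` at `s`. This is `pointTransfer` with the
registered (fully explicit) signature. [folklore] -/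
theorem stub_transfer : ∀ s : ℝ, 1 < s → s < 2 → (∀ l : ℝ, s < l → l < 2 → ∀ ε : ℝ, 0 < ε → ε < 1 / 2 → ∀ η : ℝ, 0 < η → ∃ K : ℝ, ∀ (C₀ c₁ c₂ c₃ : ℕ) (X Y Z : Fin (Literature.NumberTheory.DiophantineGeometry.AbcShapes.numShapes ε) → ℕ), Literature.NumberTheory.DiophantineGeometry.AbcShapes.Admissible l ε C₀ c₁ c₂ c₃ X Y Z → (Literature.NumberTheory.DiophantineGeometry.AbcShapes.shapeCount c₁ c₂ c₃ X Y Z : ℝ) ≤ K * (C₀ : ℝ) ^ (l - 1 + 3 * ε + η)) → ∀ ε : ℝ, 0 < ε → ∃ C : ℝ, ∀ N : ℕ, 2 ≤ N → (Set.ncard {t : ℕ × ℕ × ℕ | Literature.NumberTheory.DiophantineGeometry.IsABCTriple t.1 t.2.1 t.2.2 ∧ t.2.2 ≤ N ∧ ((Literature.NumberTheory.DiophantineGeometry.rad t.1 t.2.1 t.2.2 : ℕ) : ℝ) ≤ (t.2.2 : ℝ) ^ s} : ℝ) ≤ C * (N : ℝ) ^ (s - 1 + ε) := by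
  intro s hs1 hs2 hBox ε hε
  exact pointTransfer hs1 hs2 hBox hε

end Summit.ABC.ABC.Theorems.MazurKaneLaw

end
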